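import Mathlib

/-!
# The trace polynomial of Lehmer's polynomial is irreducible (venture `DiscreteObjects`, target L)

Cell `pub-namedobj`, seat `pub-namedobj-mahler` (gen 9). Framing: lottery ticket; floor = certified
bounds/negative ranges.

Lehmer's polynomial `L = x¹⁰+x⁹-x⁷-x⁶-x⁵-x⁴-x³+x+1` is `x⁵·Q(x + 1/x)` with the trace polynomial
`Q(y) = y⁵ + y⁴ - 5y³ - 5y² + 4y + 3` (`LehmerExactMeasure.lehmer_eval_eq_trace`).  Here: `Q` is
irreducible over `ℤ`, because its reduction `y⁵ + y⁴ + y³ + y² + 1` modulo `2` is irreducible over `𝔽₂`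
(no root in `𝔽₂`, and not divisible by the unique irreducible quadratic `y² + y + 1`, since
`y⁵+y⁴+y³+y²+1 = (y²+y+1)(y³+1) + y`).  Used in `LehmerIrreducible` to prove that `L` itself is irreducible.

* `irreducible_lehmerTrace_mod_two` — irreducibility over `ZMod 2`;
* `irreducible_lehmerTrace` — **`y⁵ + y⁴ - 5y³ - 5y² + 4y + 3` is irreducible over `ℤ`**.
-/

namespace Summit.Ventures.DiscreteObjects.Mahler

open Polynomial

/-- `2 = 0` in `𝔽₂[X]`. -/
theorem two_eq_zero_zmod_two_poly : (2 : (ZMod 2)[X]) = 0 := by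
  have h := CharP.cast_eq_zero (R := (ZMod 2)[X]) 2
  simpa using h

/-- The reduction of the trace polynomial modulo `2`. -/
theorem lehmerTrace_map_mod_two :
    (X ^ 5 + X ^ 4 - 5 * X ^ 3 - 5 * X ^ 2 + 4 * X + 3 : ℤ[X]).map (Int.castRingHom (ZMod 2)) =
      X ^ 5 + X ^ 4 + X ^ 3 + X ^ 2 + 1 := by
  have e : (X ^ 5 + X ^ 4 - 5 * X ^ 3 - 5 * X ^ 2 + 4 * X + 3 : ℤ[X]) =
      X ^ 5 + X ^ 4 - C 5 * X ^ 3 - C 5 * X ^ 2 + C 4 * X + C 3 := by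
    simp only [map_ofNat]
  have h5 : ((5 : ℤ) : ZMod 2) = 1 := by decide
  have h4 : ((4 : ℤ) : ZMod 2) = 0 := by decide
  have h3 : ((3 : ℤ) : ZMod 2) = 1 := by decide
  rw [e]
  simp only [Polynomial.map_add, Polynomial.map_sub, Polynomial.map_mul, Polynomial.map_pow, map_X,
    Polynomial.map_C]
  simp only [eq_intCast, h5, h4, h3, map_one, map_zero, zero_mul, add_zero]
  linear_combination (-(X ^ 3 + X ^ 2 : (ZMod 2)[X])) * two_eq_zero_zmod_two_poly

/-- `q = y⁵ + y⁴ + y³ + y² + 1` has no root in `𝔽₂`. -/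
theorem lehmerTrace_mod_two_eval_ne_zero (r : ZMod 2) :
    (X ^ 5 + X ^ 4 + X ^ 3 + X ^ 2 + 1 : (ZMod 2)[X]).eval r ≠ 0 := by
  simp only [eval_add, eval_pow, eval_X, eval_one]
  have h01 : ∀ c : ZMod 2, c = 0 ∨ c = 1 := by decide
  rcases h01 r with h | h <;> rw [h] <;> decide

/-- **`y⁵ + y⁴ + y³ + y² + 1` is irreducible over `𝔽₂`.** -/
theorem irreducible_lehmerTrace_mod_two :
    Irreducible (X ^ 5 + X ^ 4 + X ^ 3 + X ^ 2 + 1 : (ZMod 2)[X]) := by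
  set q : (ZMod 2)[X] := X ^ 5 + X ^ 4 + X ^ 3 + X ^ 2 + 1 with hq
  have hqdeg : q.natDegree = 5 := by rw [hq]; compute_degree!
  have hqm : q.Monic := by rw [hq]; monicity!
  have hq1 : q ≠ 1 := by
    intro h
    have := congrArg natDegree h
    rw [hqdeg, natDegree_one] at this
    exact absurd this (by norm_num)
  have h01 : ∀ c : ZMod 2, c = 0 ∨ c = 1 := by decide
  rw [hqm.irreducible_iff_lt_natDegree_lt hq1]
  intro d hdm hdeg hdvd
  rw [hqdeg, Finset.mem_Ioc] at hdeg
  -- a root of `d` would be a root of `q`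
  have hnoroot : ∀ r : ZMod 2, d.eval r ≠ 0 := by
    intro r hr
    obtain ⟨e, he⟩ := hdvd
    have : q.eval r = 0 := by rw [he, eval_mul, hr, zero_mul]
    exact lehmerTrace_mod_two_eval_ne_zero r (by rw [← hq]; exact this)
  rcases (show d.natDegree = 1 ∨ d.natDegree = 2 by omega) with h1 | h2
  · -- degree 1: `d = X + c` has the root `c` (`= -c` in characteristic 2)
    have hd := hdm.eq_X_add_C h1
    rcases h01 (d.coeff 0) with hc | hc
    · exact hnoroot 0 (by rw [hd, hc]; simp)
    · exact hnoroot 1 (by rw [hd, hc, eval_add, eval_X, eval_C]; decide)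
  · -- degree 2: `d = X² + c₁ X + c₀`
    have hd : d = X ^ 2 + C (d.coeff 1) * X + C (d.coeff 0) := by
      conv_lhs => rw [hdm.as_sum, h2]
      simp only [Finset.sum_range_succ, Finset.sum_range_zero, zero_add, pow_zero, mul_one, pow_one]
      ring
    rcases h01 (d.coeff 0) with hc0 | hc0 <;> rcases h01 (d.coeff 1) with hc1 | hc1 <;>
      rw [hc0, hc1] at hd
    · -- `X²`: root `0`
      exact hnoroot 0 (by rw [hd]; simp)
    · -- `X² + X`: root `0`
      exact hnoroot 0 (by rw [hd]; simp)
    · -- `X² + 1`: root `1`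
      refine hnoroot 1 ?_
      rw [hd, map_zero, zero_mul, add_zero, map_one, eval_add, eval_pow, eval_X, eval_one]
      decide
    · -- `X² + X + 1`: `q = (X²+X+1)(X³+1) + X`, so `X² + X + 1 ∣ X`, impossible
      rw [map_one, one_mul] at hd
      rw [hd] at hdvd
      have hrem : q = (X ^ 2 + X + 1) * (X ^ 3 + 1) + X := by
        rw [hq]
        linear_combination (-(X : (ZMod 2)[X])) * two_eq_zero_zmod_two_poly
      have hX : (X ^ 2 + X + 1 : (ZMod 2)[X]) ∣ X := by
        have h := dvd_sub hdvd (dvd_mul_right (X ^ 2 + X + 1 : (ZMod 2)[X]) (X ^ 3 + 1))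
        have e : q - (X ^ 2 + X + 1) * (X ^ 3 + 1) = X := by rw [hrem]; ring
        rwa [e] at h
      have hdeg2 : (X ^ 2 + X + 1 : (ZMod 2)[X]).natDegree = 2 := by compute_degree!
      have := natDegree_le_of_dvd hX X_ne_zero
      rw [hdeg2, natDegree_X] at this
      omega

/-- **The trace polynomial `y⁵ + y⁴ - 5y³ - 5y² + 4y + 3` of Lehmer's polynomial is irreducible over `ℤ`.** -/
theorem irreducible_lehmerTrace :
    Irreducible (X ^ 5 + X ^ 4 - 5 * X ^ 3 - 5 * X ^ 2 + 4 * X + 3 : ℤ[X]) := by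
  refine Monic.irreducible_of_irreducible_map (Int.castRingHom (ZMod 2)) _ (by monicity!) ?_
  rw [lehmerTrace_map_mod_two]
  exact irreducible_lehmerTrace_mod_two

end Summit.Ventures.DiscreteObjects.Mahler
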